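import Summits.PneNP.PneNP.Theses.RootDecompLinearSpace
import Literature.Computability.Complexity.TimeHierarchyProofs
import Literature.Computability.Complexity.TimeConstructibleClosure
import Literature.Computability.Complexity.PaulPippengerSzemerediTrotter1983Clocks

/-!
# `RootDecompLinearSpace.NotPSubsetDTIMELin` (stmt-PneNP-31867) — the k = 0 cell of the linear-hierarchy dial is refuted

Node N37 of the decomp-pnenp root-decomposition cell (route `route-PneNP-RootDecompLinearSpace`) files
as a decided aside the `k = 0` cell of lens-4 g11's LINEAR-HIERARCHY DIAL `Y k := «P ⊆ ΣₖTIME(n)»`: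
«P ⊄ DTIME(n)» — REFUTED regime of the three-regime dial law (k = 0 refuted / 1 ≤ k < ω strong /
k = ω inert).  Kernel: the deterministic time hierarchy `DTIME(n) ⊊ DTIME(n³)` (tree theorem
`time_hierarchy_holds` with `isTimeConstructible_id`, `isTimeConstructible_id.pow`) and `DTIME(n³) ⊆ P`.
Port of the lens-4 g11 kernel `not_Y_zero` (HOME/decomp-pnenp-lens-4/LinearHierarchyLift.lean sha256
a60f9a07…, writer pack `notPSubsetDTIMELin_holds`).  0 sorry.
[cite: HartmanisStearns1965; AroraBarak2009, Thm 3.1]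
-/

namespace Summit.PneNP.PneNP.Theorems

open Filter Topology
open Literature.Computability.Complexity

/-- Time hierarchy instance: `DTIME(n) ⊊ DTIME(n³)` (port of the lens lemma
`DTIME_id_ssubset_DTIME_cube`). [cite: AroraBarak2009, Thm 3.1] -/
private theorem linHier_DTIME_id_ssubset_DTIME_cube :
    DTIME (fun n => n) ⊂ DTIME (fun n => n ^ 3) := by
  have hT : IsTimeConstructible (fun n : ℕ => n) := isTimeConstructible_id
  have hU : IsTimeConstructible (fun n : ℕ => n ^ 3) := isTimeConstructible_id.pow (by norm_num)
  have hlim : Tendsto (fun n : ℕ => ((n : ℕ) : ℝ) ^ 2 / ((n ^ 3 : ℕ) : ℝ)) atTop (𝓝 0) := by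
    have h := (tendsto_pow_div_pow_atTop_zero (𝕜 := ℝ) (show 2 < 3 by norm_num)).comp
      tendsto_natCast_atTop_atTop
    refine Tendsto.congr (fun n => ?_) h
    simp only [Function.comp_apply, Nat.cast_pow]
  exact time_hierarchy_holds (fun n => n) (fun n => n ^ 3) hT hU hlim

/-- The `k = 0` cell of the linear-hierarchy dial is REFUTED (stmt-PneNP-31867, `NotPSubsetDTIMELin`):
`¬ (P ⊆ DTIME(n))`, since `DTIME(n) ⊊ DTIME(n³) ⊆ P` by the time hierarchy.  Port of the lens-4 g11
kernel `not_Y_zero` (decomp-pnenp cell, 2026-08-30). [cite: AroraBarak2009, Thm 3.1] -/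
theorem notPSubsetDTIMELin_proof :
    Summit.PneNP.PneNP.Theses.RootDecompLinearSpace.NotPSubsetDTIMELin := by
  unfold Summit.PneNP.PneNP.Theses.RootDecompLinearSpace.NotPSubsetDTIMELin
  intro hY
  obtain ⟨L, hL3, hL1⟩ := Set.exists_of_ssubset linHier_DTIME_id_ssubset_DTIME_cube
  exact hL1 (hY (Set.subset_iUnion (fun k : ℕ => DTIME fun n => n ^ k) 3 hL3))

end Summit.PneNP.PneNP.Theorems
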